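import Summits.HodgeConjecture.CorCM.Census.HalfParityStabiliser

/-!
# The half-parity law, XII: the CHARACTER FUNCTIONALS `θ_χ` — stabiliser characters, transporters, and which `θ_χ` die on the fibre

COR-CM (cell `pub-hodgecm2`), count-neutral kernel combinatorics by the binder seat b09 (gen 31; lane DIRECT-FACTOR, sequel
«CLOSED-FORM LAW»), part XII of the HALF-PARITY series, sequel of `Census/HalfParityStabiliser.lean` (XI).  Two bookkeeping
definitions with bodies (`trp`, a transporter from the block representative; `theta`, the character functional) + theorems; no
`decide` beyond closed identities in `𝔽₂`, no certificate, no named fact, no `sorry`.  HONEST FRAMING: `HC_CM` is NOT proved; nothing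
here is a period or a headline.

THE OBJECTS.  A **stabiliser character** is an additive `χ : G → 𝔽₂` (`χ(ab) = χ(a) + χ(b)`) with `χ(c) = 0` killing every
stabiliser `stab Ψ` (lit-andre-3ʼs `Hom(G/𝒦, 𝔽₂)`).  Its **character functional** `θ_χ [Ψ] := χ(Q)` for any `Q` with
`Ψ = out(blk Ψ)·Q⁻¹` (`theta`, read through a chosen transporter `trp`; `theta_single_rt_out`: the choice is immaterial) satisfies
(§1) `θ_χ(v·Q⁻¹) = θ_χ(v) + χ(Q)·mass(v)` (`theta_mapDomain_rt`), kills `rad2` (`rad2_le_ker_theta`), and equals the stabiliser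
half-parity of `ker χ` plus the mass (`theta_eq_hsum_halfOf_add_mass`, XI): so ON THE FIBRE the `θ_χ` are exactly the half-parities,
and `χ ↦ θ_χ` is LINEAR (`theta_add`).
THE THEOREM OF THIS PART — **(E5) WHICH `θ_χ` VANISH ON `hodge2 ∩ ker par2`** (`char_eq_zero_or_transfer`): if `θ_χ(x) = 0` for
every Hodge vector `x` with zero block parities, then `χ = 0`, or `|G|/2` is even and `χ` is THE TRANSFER PARITY
`Q ↦ wpar T₀ (T₀·Q⁻¹)` (`= [Qⁿ ≠ 1]`, gen 28).  Proof: `θ_χ` is then a parity combination plus a functional `d` killing `hodge2`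
(factor through `par2`), `d(v·Q⁻¹) = d(v) + χ(Q)·mass(v)`; the gradient of `d` (IX) is `G`-invariant, hence a constant `κ`;
`κ = 0` makes `d` a multiple of the mass and `χ = 0`; `κ = 1` makes `d[Ψ] = d[T₀] + wpar T₀ Ψ` (walk along the deviation set), the
pair relation forces `n` even, and the coboundary at `[T₀]` reads `χ(Q) = wpar T₀ (T₀·Q⁻¹)` (`hom_cases_of_coboundary`).
Conversely (§4) for `n` even the transfer parity IS a stabiliser character whose `θ` dies on the fibre (`theta_transfer_eq_zero`).
With X–XI: **`t(G,c) = dim{stabiliser characters} − [n even ∧ δ = 0]`** is the content; the dimension count itself is part XIII.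

## References
* [Pohlmann1968] H. Pohlmann, Algebraic cycles on abelian varieties of complex multiplication type, Ann. of Math. 88 (1968), Thm 1.
-/

namespace Summit.HodgeConjecture.CorCM.Census.HalfParity

open Finset
open Summit.HodgeConjecture.CorCM.Prior.AllgGroup.RfwfAllgGroup
open Summit.HodgeConjecture.CorCM.Census.BlockParity
open Summit.HodgeConjecture.CorCM.Census.Coinvariant

noncomputable section

variable {G : Type*} [Group G] [Fintype G] [DecidableEq G] (c : G)

/-! ## §1 Transporters and the character functional -/

/-- Every type is a base change of the representative of its block. [folklore] -/
theorem exists_rt_out_eq (Ψ : CMF G c) : ∃ Q : G, rt c Q (Quotient.out (blk c Ψ)) = Ψ :=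
  exists_rt_eq_of_blk_eq c (Quotient.out_eq _)

/-- **A transporter** `trp Ψ` with `out(blk Ψ)·(trp Ψ)⁻¹ = Ψ` (a choice). [folklore] -/
def trp (Ψ : CMF G c) : G := Classical.choose (exists_rt_out_eq c Ψ)

/-- The defining property of the transporter. [folklore] -/
theorem rt_trp (Ψ : CMF G c) : rt c (trp c Ψ) (Quotient.out (blk c Ψ)) = Ψ := Classical.choose_spec (exists_rt_out_eq c Ψ)

/-- **The character functional** `θ_χ : [Ψ] ↦ χ(trp Ψ)`. [folklore] -/
def theta (χ : G → ZMod 2) : (CMF G c →₀ ZMod 2) →ₗ[ZMod 2] ZMod 2 :=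
  Finsupp.linearCombination (ZMod 2) fun Ψ => χ (trp c Ψ)

/-- `θ_χ [Ψ]·r = r·χ(trp Ψ)`. [folklore] -/
@[simp] theorem theta_single (χ : G → ZMod 2) (Ψ : CMF G c) (r : ZMod 2) :
    theta c χ (Finsupp.single Ψ r) = r * χ (trp c Ψ) := by
  rw [theta, Finsupp.linearCombination_single, smul_eq_mul]

/-- `θ` is additive in the character. [folklore] -/
theorem theta_add (χ₁ χ₂ : G → ZMod 2) : theta c (χ₁ + χ₂) = theta c χ₁ + theta c χ₂ := by
  refine LinearMap.ext fun v => ?_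
  induction v using Finsupp.induction_linear with
  | zero => simp
  | add f g hf hg => rw [map_add, hf, hg, map_add]
  | single Ψ r => rw [LinearMap.add_apply, theta_single, theta_single, theta_single, Pi.add_apply, mul_add]

/-- `θ_0 = 0`. [folklore] -/
@[simp] theorem theta_zero : theta c (0 : G → ZMod 2) = 0 := by
  refine LinearMap.ext fun v => ?_
  induction v using Finsupp.induction_linear with
  | zero => simp
  | add f g hf hg => rw [map_add, map_add, hf, hg]
  | single Ψ r => rw [theta_single, Pi.zero_apply, mul_zero, LinearMap.zero_apply]

/-- `θ` of a finite sum of characters. [folklore] -/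
theorem theta_sum {ι : Type*} (s : Finset ι) (χ : ι → G → ZMod 2) : theta c (∑ i ∈ s, χ i) = ∑ i ∈ s, theta c (χ i) := by
  classical
  induction s using Finset.induction_on with
  | empty => rw [Finset.sum_empty, Finset.sum_empty, theta_zero]
  | insert i s hi ih => rw [Finset.sum_insert hi, Finset.sum_insert hi, theta_add, ih]

section Character

variable {χ : G → ZMod 2} (hadd : ∀ a b : G, χ (a * b) = χ a + χ b) (hst : ∀ (Ψ : CMF G c) (Q : G), rt c Q Ψ = Ψ → χ Q = 0)
include hadd

omit [Fintype G] [DecidableEq G] in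
/-- An additive map to `𝔽₂` is even: `χ(a⁻¹) = χ(a)` (and kills `1`). [folklore] -/
theorem char_inv (a : G) : χ a⁻¹ = χ a := by
  have h1 : χ 1 = 0 := by
    have h := hadd 1 1
    rw [mul_one] at h
    have key : ∀ x : ZMod 2, x = x + x → x = 0 := by decide
    exact key _ h
  have h := hadd a a⁻¹
  rw [mul_inv_cancel, h1] at h
  have key : ∀ x y : ZMod 2, 0 = x + y → y = x := by decide
  exact key _ _ h

include hst in
/-- **The transporter does not matter**: `θ_χ [out(b)·Q⁻¹] = χ(Q)` for EVERY `Q`, when `χ` kills the stabilisers. [folklore] -/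
theorem theta_single_rt_out (b : Block c) (Q : G) (r : ZMod 2) :
    theta c χ (Finsupp.single (rt c Q (Quotient.out b)) r) = r * χ Q := by
  rw [theta_single]
  congr 1
  have hb : blk c (rt c Q (Quotient.out b)) = b := by rw [blk_rt]; exact Quotient.out_eq b
  have hT := rt_trp c (rt c Q (Quotient.out b))
  rw [hb] at hT
  set T := trp c (rt c Q (Quotient.out b)) with hTdef
  have hmem : rt c (T⁻¹ * Q) (Quotient.out b) = Quotient.out b := by
    rw [rt_mul, ← hT, rt_inv_rt]
  have h := hst _ _ hmem
  rw [hadd, char_inv hadd] at h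
  have key : ∀ x y : ZMod 2, x + y = 0 → x = y := by decide
  exact key _ _ h

include hst in
/-- **The coboundary of `θ_χ` is `χ ∪ mass`**: `θ_χ(v·Q⁻¹) = θ_χ(v) + χ(Q)·mass(v)`. [folklore] -/
theorem theta_mapDomain_rt (Q : G) (v : CMF G c →₀ ZMod 2) :
    theta c χ (Finsupp.mapDomain (rt c Q) v) = theta c χ v + χ Q * mass c v := by
  induction v using Finsupp.induction_linear with
  | zero => simp
  | add f g hf hg => rw [Finsupp.mapDomain_add, map_add, map_add, map_add, hf, hg]; ring
  | single Ψ r =>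
    obtain ⟨Q₀, hQ₀⟩ := exists_rt_out_eq c Ψ
    rw [Finsupp.mapDomain_single, mass_single, ← hQ₀, ← rt_mul, theta_single_rt_out c hadd hst, theta_single_rt_out c hadd hst,
      hadd]
    ring

include hst in
/-- `θ_χ` kills the pairs when `χ(c) = 0`. [folklore] -/
theorem theta_red_pair (hc0 : χ c = 0) (Ψ : CMF G c) : theta c χ (red c (pair c Ψ)) = 0 := by
  obtain ⟨Q₀, hQ₀⟩ := exists_rt_out_eq c Ψ
  rw [red_pair, map_add, ← hQ₀, ← rt_mul, theta_single_rt_out c hadd hst, theta_single_rt_out c hadd hst, hadd, hc0]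
  have key : ∀ x : ZMod 2, 1 * x + 1 * (0 + x) = 0 := by decide
  exact key _

include hst in
/-- **`θ_χ` kills `rad2`** (pairs, and coboundaries of faces since the mass kills `hodge2`). [folklore] -/
theorem rad2_le_ker_theta (hc2 : c * c = 1) (hcen : ∀ x : G, x * c = c * x) (hc0 : χ c = 0) :
    rad2 c hc2 ≤ LinearMap.ker (theta c χ) := by
  refine sup_le ?_ ?_
  · rw [pair2, Submodule.span_le]
    rintro _ ⟨_, ⟨Ψ, rfl⟩, rfl⟩
    exact LinearMap.mem_ker.mpr (theta_red_pair c hadd hst hc0 Ψ)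
  · rw [aug2, Submodule.span_le]
    rintro _ ⟨Q, x, hx, rfl⟩
    rw [SetLike.mem_coe, LinearMap.mem_ker, map_sub, theta_mapDomain_rt c hadd hst,
      mass_eq_zero_of_mem_hodge2 c hc2 hcen (Submodule.mem_sup_left (Submodule.subset_span hx) : x ∈ hodge2 c hc2)]
    ring

include hst in
/-- **`θ_χ` is the stabiliser half-parity of `ker χ` plus the mass** (so on the fibre the `θ_χ` ARE the half-parities). [folklore] -/
theorem theta_eq_hsum_halfOf_add_mass (v : CMF G c →₀ ZMod 2) :
    theta c χ v = hsum c (halfOf c (addKer χ hadd) univ) v + mass c v := by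
  have hst' : ∀ Ψ : CMF G c, stab c Ψ ≤ addKer χ hadd := fun Ψ Q hQ => (mem_addKer χ hadd Q).mpr (hst Ψ Q hQ)
  induction v using Finsupp.induction_linear with
  | zero => simp
  | add f g hf hg => rw [map_add, map_add, map_add, hf, hg]; ring
  | single Ψ r =>
    obtain ⟨Q₀, hQ₀⟩ := exists_rt_out_eq c Ψ
    have hb : blk c (Quotient.out (blk c Ψ)) = blk c Ψ := Quotient.out_eq _
    rw [← hQ₀, theta_single_rt_out c hadd hst, hsum_single, mass_single]
    have hmem : rt c Q₀ (Quotient.out (blk c Ψ)) ∈ halfOf c (addKer χ hadd) univ ↔ Q₀ ∈ addKer χ hadd := by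
      rw [mem_halfOf_univ_iff, blk_rt, hb, mem_horb_out_iff c (hst' _)]
    have two1 : ∀ y : ZMod 2, y ≠ 0 → y = 1 := by decide
    have kpos : ∀ r : ZMod 2, r * 0 = r + r := by decide
    have kneg : ∀ r : ZMod 2, r * 1 = 0 + r := by decide
    by_cases h : Q₀ ∈ addKer χ hadd
    · rw [if_pos (hmem.mpr h), (mem_addKer χ hadd Q₀).mp h]
      exact kpos _
    · rw [if_neg (fun h' => h (hmem.mp h')), two1 _ (fun h' => h ((mem_addKer χ hadd Q₀).mpr h'))]
      exact kneg _

end Character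

/-! ## §2 (E5) A functional killing `hodge2` with coboundary `χ·mass`: `χ = 0` or the transfer parity -/

/-- **Graded walk**: if every flip changes `d` by `κ`, then `d[Ψ] = d[T₀] + κ·wpar T₀ Ψ`. [folklore] -/
theorem apply_single_eq_of_grad_const (hc2 : c * c = 1) {d : (CMF G c →₀ ZMod 2) →ₗ[ZMod 2] ZMod 2} {κ : ZMod 2}
    (hgrad : ∀ (s : G) (Φ : CMF G c), d (Finsupp.single (oflipCM c hc2 s Φ) 1) = d (Finsupp.single Φ 1) + κ)
    (T₀ Ψ : CMF G c) : d (Finsupp.single Ψ 1) = d (Finsupp.single T₀ 1) + κ * wpar c T₀ Ψ := by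
  suffices h : ∀ n : ℕ, ∀ Ψ : CMF G c, (T₀.1 \ Ψ.1).card = n →
      d (Finsupp.single Ψ 1) = d (Finsupp.single T₀ 1) + κ * wpar c T₀ Ψ from h _ Ψ rfl
  intro n
  induction n with
  | zero =>
    intro Ψ h
    rw [Finset.card_eq_zero] at h
    rw [eq_of_dev_empty c h, wpar_self, mul_zero, add_zero]
  | succ n ih =>
    intro Ψ h
    obtain ⟨s, hs⟩ := Finset.card_pos.mp (by omega : 0 < (T₀.1 \ Ψ.1).card)
    have hsT : s ∈ T₀.1 := (Finset.mem_sdiff.mp hs).1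
    have hsΨ : s ∉ Ψ.1 := (Finset.mem_sdiff.mp hs).2
    have hcard : (T₀.1 \ (oflipCM c hc2 s Ψ).1).card = n := by
      rw [dev_oflip c hc2 hsT hsΨ, Finset.card_erase_of_mem hs, h]; rfl
    have h1 := ih _ hcard
    rw [wpar_oflipCM] at h1
    have h2 := hgrad s (oflipCM c hc2 s Ψ)
    rw [oflipCM_oflipCM_self] at h2
    rw [h2, h1]
    have key : ∀ x k w : ZMod 2, x + k * (w + 1) + k = x + k * w := by decide
    exact key _ _ _

/-- `wpar T₀ (T₀·c) = |T₀| = |G|/2` (mod `2`): the conjugate type deviates at every place. [folklore] -/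
theorem wpar_rt_self_conj (hc2 : c * c = 1) (hcen : ∀ x : G, x * c = c * x) (T₀ : CMF G c) :
    wpar c T₀ (rt c c T₀) = ((Fintype.card G / 2 : ℕ) : ZMod 2) := by
  have hs : T₀.1 \ (univ \ T₀.1) = T₀.1 := by
    ext x; simp
  rw [wpar, rt_self_val c hcen, hs]
  congr 1
  have h := two_mul_card_val c hc2 T₀
  omega

/-- **(E5) CORE.**  Let `d` kill `hodge2` and satisfy `d(v·Q⁻¹) = d(v) + χ(Q)·mass(v)` for all `Q, v`.  Then either `χ = 0`, or
`|G|/2` is even and `χ` is the transfer parity `Q ↦ wpar T₀ (T₀·Q⁻¹)`. [folklore] -/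
theorem hom_cases_of_coboundary (hc2 : c * c = 1) (hc1 : c ≠ 1) (hcen : ∀ x : G, x * c = c * x)
    {d : (CMF G c →₀ ZMod 2) →ₗ[ZMod 2] ZMod 2} (hd : hodge2 c hc2 ≤ LinearMap.ker d) {χ : G → ZMod 2}
    (hcob : ∀ (Q : G) (v : CMF G c →₀ ZMod 2), d (Finsupp.mapDomain (rt c Q) v) = d v + χ Q * mass c v) (T₀ : CMF G c) :
    (∀ Q, χ Q = 0) ∨ (Even (Fintype.card G / 2) ∧ ∀ Q, χ Q = wpar c T₀ (rt c Q T₀)) := by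
  -- the gradient of `d` is `G`-invariant, hence constant
  set γ : G → ZMod 2 := fun t => d (Finsupp.single (oflipCM c hc2 t T₀) 1) + d (Finsupp.single T₀ 1) with hγ
  have hγQ : ∀ Q t, γ (t * Q⁻¹) = γ t := by
    intro Q t
    have h1 := hcob Q (Finsupp.single (oflipCM c hc2 t T₀) 1)
    have h2 := hcob Q (Finsupp.single T₀ 1)
    rw [Finsupp.mapDomain_single, mass_single, rt_oflipCM c hc2] at h1
    rw [Finsupp.mapDomain_single, mass_single] at h2
    rw [hγ]
    beta_reduce
    rw [apply_flip_add_indep c hc2 hc1 hcen hd (t * Q⁻¹) T₀ (rt c Q T₀), h1, h2]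
    have key : ∀ a b x : ZMod 2, a + x * 1 + (b + x * 1) = a + b := by decide
    exact key _ _ _
  have hγ1 : ∀ t, γ t = γ 1 := fun t => by
    have h := hγQ t t
    rw [mul_inv_cancel] at h
    exact h.symm
  -- every flip changes `d` by the constant `κ = γ 1`
  have hgrad : ∀ (s : G) (Φ : CMF G c), d (Finsupp.single (oflipCM c hc2 s Φ) 1) = d (Finsupp.single Φ 1) + γ 1 := by
    intro s Φ
    rw [← hγ1 s, hγ]
    beta_reduce
    rw [apply_flip_add_indep c hc2 hc1 hcen hd s T₀ Φ]
    have key : ∀ a b : ZMod 2, a = b + (a + b) := by decide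
    exact key _ _
  have hwalk := apply_single_eq_of_grad_const c hc2 hgrad T₀
  -- the coboundary at `[T₀]`: `χ(Q) = κ · wpar T₀ (T₀·Q⁻¹)`
  have hχ : ∀ Q, χ Q = γ 1 * wpar c T₀ (rt c Q T₀) := fun Q => by
    have h := hcob Q (Finsupp.single T₀ 1)
    rw [Finsupp.mapDomain_single, mass_single, mul_one, hwalk] at h
    have key : ∀ a b x : ZMod 2, a + b = a + x → x = b := by decide
    exact key _ _ _ h
  have two1 : ∀ y : ZMod 2, y ≠ 0 → y = 1 := by decide
  by_cases hκ : γ 1 = 0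
  · exact Or.inl fun Q => by rw [hχ Q, hκ, zero_mul]
  · have hκ1 := two1 _ hκ
    refine Or.inr ⟨?_, fun Q => by rw [hχ Q, hκ1, one_mul]⟩
    -- the pair `[T₀] + [T₀·c]` is a Hodge vector: `κ · |T₀| = 0`
    have hp : d (Finsupp.single T₀ 1) + d (Finsupp.single (rt c c T₀) 1) = 0 := by
      rw [← map_add, ← red_pair]
      exact LinearMap.mem_ker.mp (hd (Submodule.mem_sup_right (red_mem_pair2 c (Submodule.subset_span (pair_mem_pairSet c T₀)))))
    rw [hwalk (rt c c T₀), hκ1, one_mul, wpar_rt_self_conj c hc2 hcen T₀] at hp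
    have key : ∀ a x : ZMod 2, a + (a + x) = 0 → x = 0 := by decide
    exact (ZMod.natCast_eq_zero_iff_even).mp (key _ _ hp)

/-! ## §3 Which stabiliser characters die on the fibre -/

/-- **Factoring through the block parities**: a functional vanishing on `hodge2 ∩ ker par2` is, ON `hodge2`, a block-parity
combination. [folklore] -/
theorem exists_sum_par2_of_vanish {w : (CMF G c →₀ ZMod 2) →ₗ[ZMod 2] ZMod 2} (hc2 : c * c = 1)
    (hw : ∀ x ∈ hodge2 c hc2, par2 c x = 0 → w x = 0) :
    ∃ a : Block c → ZMod 2, ∀ x ∈ hodge2 c hc2, w x = ∑ b, a b * par2 c x b := by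
  set W := hodge2 c hc2 with hW
  set g : ↥W →ₗ[ZMod 2] (Block c → ZMod 2) := (par2 c).domRestrict W with hg
  set f : ↥W →ₗ[ZMod 2] ZMod 2 := w.domRestrict W with hf
  have hker : LinearMap.ker g ≤ LinearMap.ker f := fun x hx => by
    rw [LinearMap.mem_ker, hf, LinearMap.domRestrict_apply]
    rw [LinearMap.mem_ker, hg, LinearMap.domRestrict_apply] at hx
    exact hw x.1 x.2 hx
  -- `f` factors through `range g`, then extend to all of `𝔽₂^{blocks}`
  set φ₁ : ↥(LinearMap.range g) →ₗ[ZMod 2] ZMod 2 := ((LinearMap.ker g).liftQ f hker) ∘ₗ g.quotKerEquivRange.symm.toLinearMap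
    with hφ₁
  obtain ⟨φ, hφ⟩ := LinearMap.exists_extend φ₁
  refine ⟨fun b => φ (fun j => if b = j then (1 : ZMod 2) else 0), fun x hx => ?_⟩
  have h1 : w x = φ (par2 c x) := by
    have e1 : φ (par2 c x) = φ₁ ⟨g ⟨x, hx⟩, LinearMap.mem_range_self g ⟨x, hx⟩⟩ := by
      rw [← hφ]; rfl
    rw [e1, hφ₁, LinearMap.comp_apply, LinearEquiv.coe_toLinearMap, LinearMap.quotKerEquivRange_symm_apply_image,
      Submodule.mkQ_apply, Submodule.liftQ_apply]
    rfl
  rw [h1, LinearMap.pi_apply_eq_sum_univ φ (par2 c x)]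
  exact Finset.sum_congr rfl fun b _ => by rw [smul_eq_mul, mul_comm]

/-- **(E5) FOR STABILISER CHARACTERS.**  If `θ_χ` vanishes on `hodge2 ∩ ker par2` then `χ = 0`, or `|G|/2` is even and `χ` is the
transfer parity. [folklore] -/
theorem char_eq_zero_or_transfer (hc2 : c * c = 1) (hc1 : c ≠ 1) (hcen : ∀ x : G, x * c = c * x) {χ : G → ZMod 2}
    (hadd : ∀ a b : G, χ (a * b) = χ a + χ b) (hst : ∀ (Ψ : CMF G c) (Q : G), rt c Q Ψ = Ψ → χ Q = 0)
    (hK : ∀ x ∈ hodge2 c hc2, par2 c x = 0 → theta c χ x = 0) (T₀ : CMF G c) :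
    (∀ Q, χ Q = 0) ∨ (Even (Fintype.card G / 2) ∧ ∀ Q, χ Q = wpar c T₀ (rt c Q T₀)) := by
  obtain ⟨a, ha⟩ := exists_sum_par2_of_vanish c hc2 hK
  set d : (CMF G c →₀ ZMod 2) →ₗ[ZMod 2] ZMod 2 := theta c χ - ∑ b, a b • (LinearMap.proj b ∘ₗ par2 c) with hd
  have hdap : ∀ v, d v = theta c χ v - ∑ b, a b * par2 c v b := fun v => by
    rw [hd, LinearMap.sub_apply, LinearMap.sum_apply]
    simp only [LinearMap.smul_apply, LinearMap.comp_apply, LinearMap.proj_apply, smul_eq_mul]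
  refine hom_cases_of_coboundary c hc2 hc1 hcen (d := d) (fun x hx => ?_) (fun Q v => ?_) T₀
  · rw [LinearMap.mem_ker, hdap, ha x hx, sub_self]
  · rw [hdap, hdap, theta_mapDomain_rt c hadd hst, par2_mapDomain_rt]
    ring

/-! ## §4 The transfer parity is a stabiliser character whose `θ` dies on the fibre (`|G|/2` even) -/

/-- The weight-parity functional mod `2`: `[Ψ] ↦ wpar T₀ Ψ`. [folklore] -/
theorem wlin_two_apply (T₀ : CMF G c) (y : CMF G c →₀ ℤ) :
    Finsupp.linearCombination (ZMod 2) (wpar c T₀) (red c y) = wlin c T₀ y := by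
  induction y using Finsupp.induction_linear with
  | zero => simp
  | add f g hf hg => rw [map_add, map_add, map_add, hf, hg]
  | single Ψ n => rw [red_single, Finsupp.linearCombination_single, wlin_single, smul_eq_mul]

/-- **For `|G|/2` even the weight parity kills `hodge2`** (faces by gen 28, pairs since `wpar Ψ + wpar Ψ̄ = |G|/2`). [folklore] -/
theorem hodge2_le_ker_wlin_two (hc2 : c * c = 1) (hcen : ∀ x : G, x * c = c * x) (heven : Even (Fintype.card G / 2))
    (T₀ : CMF G c) : hodge2 c hc2 ≤ LinearMap.ker (Finsupp.linearCombination (ZMod 2) (wpar c T₀)) := by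
  refine sup_le ?_ ?_
  · rw [face2, Submodule.span_le]
    rintro _ ⟨y, ⟨Φ, t, t', -, rfl⟩, rfl⟩
    rw [SetLike.mem_coe, LinearMap.mem_ker, wlin_two_apply, wlin_gface]
  · rw [pair2, Submodule.span_le]
    rintro _ ⟨_, ⟨Ψ, rfl⟩, rfl⟩
    rw [SetLike.mem_coe, LinearMap.mem_ker, red_pair, map_add, Finsupp.linearCombination_single,
      Finsupp.linearCombination_single, one_smul, one_smul, wpar_rt c hc2 T₀ c Ψ, wpar_rt_self_conj c hc2 hcen T₀,
      (ZMod.natCast_eq_zero_iff_even).mpr heven, zero_add, CharTwo.add_self_eq_zero]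

/-- **The transfer parity is additive, kills `c` (for `|G|/2` even) and kills every stabiliser.** [folklore] -/
theorem transfer_char (hc2 : c * c = 1) (hc1 : c ≠ 1) (hcen : ∀ x : G, x * c = c * x) (heven : Even (Fintype.card G / 2))
    (T₀ : CMF G c) :
    (∀ a b : G, wpar c T₀ (rt c (a * b) T₀) = wpar c T₀ (rt c a T₀) + wpar c T₀ (rt c b T₀)) ∧
      wpar c T₀ (rt c c T₀) = 0 ∧ ∀ (Ψ : CMF G c) (Q : G), rt c Q Ψ = Ψ → wpar c T₀ (rt c Q T₀) = 0 := by
  refine ⟨fun a b => wpar_rt_mul c hc2 T₀ a b, ?_, fun Ψ Q hQ => ?_⟩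
  · rw [wpar_rt_self_conj c hc2 hcen T₀, (ZMod.natCast_eq_zero_iff_even).mpr heven]
  · rw [wpar_rt_self_eq_zero_iff c hc2 hc1 hcen T₀ Q, ← inv_inv Q, inv_pow, inv_eq_one,
      pow_half_card_eq c hc2 hc1 hcen Ψ Q⁻¹, inv_inv, hQ, Finset.sdiff_self, Finset.card_empty, pow_zero]

/-- **The `θ` of the transfer parity dies on the fibre** (`θ_V −` weight parity is an invariant ambient functional, hence a parity
combination; the weight parity kills `hodge2`). [folklore] -/
theorem theta_transfer_eq_zero (hc2 : c * c = 1) (hc1 : c ≠ 1) (hcen : ∀ x : G, x * c = c * x)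
    (heven : Even (Fintype.card G / 2)) (T₀ : CMF G c) {x : CMF G c →₀ ZMod 2} (hx : x ∈ hodge2 c hc2) (hpx : par2 c x = 0) :
    theta c (fun Q => wpar c T₀ (rt c Q T₀)) x = 0 := by
  obtain ⟨hadd, -, hst⟩ := transfer_char c hc2 hc1 hcen heven T₀
  set w := theta c (fun Q => wpar c T₀ (rt c Q T₀)) - Finsupp.linearCombination (ZMod 2) (wpar c T₀) with hw
  have hinv : ∀ (Q : G) (v : CMF G c →₀ ZMod 2), w (Finsupp.mapDomain (rt c Q) v) = w v := by
    intro Q v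
    rw [hw, LinearMap.sub_apply, LinearMap.sub_apply, theta_mapDomain_rt c hadd hst]
    have hl : Finsupp.linearCombination (ZMod 2) (wpar c T₀) (Finsupp.mapDomain (rt c Q) v) =
        Finsupp.linearCombination (ZMod 2) (wpar c T₀) v + wpar c T₀ (rt c Q T₀) * mass c v := by
      induction v using Finsupp.induction_linear with
      | zero => simp
      | add f g hf hg => rw [Finsupp.mapDomain_add, map_add, map_add, map_add, hf, hg]; ring
      | single Ψ r =>
        rw [Finsupp.mapDomain_single, Finsupp.linearCombination_single, Finsupp.linearCombination_single, mass_single,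
          wpar_rt c hc2, smul_eq_mul, smul_eq_mul]
        ring
    rw [hl]
    ring
  obtain ⟨a, ha⟩ := exists_eq_sum_par2_of_invariant c w hinv
  have h := ha x
  rw [hw, LinearMap.sub_apply, LinearMap.mem_ker.mp (hodge2_le_ker_wlin_two c hc2 hcen heven T₀ hx), sub_zero, hpx] at h
  rw [h]
  simp

end

end Summit.HodgeConjecture.CorCM.Census.HalfParity
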